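import Mathlib.Analysis.SpecialFunctions.Pow.Complex
import Mathlib.Analysis.SpecialFunctions.Pow.Real
import Mathlib.Algebra.Polynomial.Roots
import HarnessLib

/-!
# Rational functions of `q^{-s}` — rationality / regularity predicates of the local theory (A-int (A4′), DEFS leaf F1)

Supports lane of hLiu418 = stmt-HodgeConjecture-24832 (`--kind definition`, `--as helper`).  The local intertwining operator
`M_w(s)` applied to a standard section of `I_w(s, χ_w)` is a rational function of `X = q_w^{-s}`, and its normalisation is regular
at `s = ½`.  The tree had no predicate for either statement; this leaf supplies `IsQRational q φ` and `IsQRationalRegularAt q s₀ φ`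
(polynomials `P, Q` with `φ s = P(q^{-s}) / Q(q^{-s})` off the zeros of `Q(q^{-s})`, resp. additionally `Q(q^{-s₀}) ≠ 0`), their
closure under the ring operations and finite sums / products, and the identity principle «two functions regular at `s₀` that agree
on a right half-plane agree at `s₀`», which lets consumers identify the value at `½` independently of the chosen continuation.
[cite: KudlaSweet1997, §1] [cite: Casselman1980, §3]
-/

noncomputable section

set_option autoImplicit false
set_option linter.dupNamespace false

open Polynomial

namespace Summit.HodgeConjecture.HodgeConjecture.Cruxes.HLiu418.K2LiuQRationalDefs

/-! ## §1 The variable `X = q^{-s}` -/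

/-- The variable `X = q^{-s}` of the local theory at a place with residue field of size `q`. [cite: Casselman1980, §3] -/
def qVar (q : ℕ) (s : ℂ) : ℂ := (q : ℂ) ^ (-s)

/-- `qVar q s = q^{-s}` (unfolding lemma). [cite: Casselman1980, §3] -/
theorem qVar_def (q : ℕ) (s : ℂ) : qVar q s = (q : ℂ) ^ (-s) := rfl

/-- `q^{-s} ≠ 0` for `q ≠ 0`. [cite: Casselman1980, §3] -/
theorem qVar_ne_zero {q : ℕ} (hq : q ≠ 0) (s : ℂ) : qVar q s ≠ 0 := fun h =>
  hq (by exact_mod_cast ((Complex.cpow_eq_zero_iff _ _).1 h).1)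

/-- `q^{-(s+t)} = q^{-s} · q^{-t}` for `q ≠ 0`. [cite: Casselman1980, §3] -/
theorem qVar_add {q : ℕ} (hq : q ≠ 0) (s t : ℂ) : qVar q (s + t) = qVar q s * qVar q t := by
  rw [qVar_def, qVar_def, qVar_def, neg_add, Complex.cpow_add _ _ (by exact_mod_cast hq)]

/-- `q^{-(s+k)} = q^{-k} · (q^{-s})` for a natural number shift. [cite: Casselman1980, §3] -/
theorem qVar_add_natCast {q : ℕ} (hq : q ≠ 0) (s : ℂ) (k : ℕ) : qVar q (s + k) = ((q : ℂ) ^ k)⁻¹ * qVar q s := by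
  rw [qVar_add hq, mul_comm, qVar_def, Complex.cpow_neg, Complex.cpow_natCast]

/-- `q^{-(k s)} = (q^{-s})^k`. [cite: Casselman1980, §3] -/
theorem qVar_natCast_mul {q : ℕ} (s : ℂ) (k : ℕ) : qVar q (k * s) = qVar q s ^ k := by
  rw [qVar_def, qVar_def, ← Complex.cpow_nat_mul, neg_mul_eq_mul_neg]

/-- On real arguments `q^{-t}` is the real power. [cite: Casselman1980, §3] -/
theorem qVar_ofReal (q : ℕ) (t : ℝ) : qVar q (t : ℂ) = (((q : ℝ) ^ (-t) : ℝ) : ℂ) := by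
  rw [qVar_def, Complex.ofReal_cpow (by positivity) (-t)]
  push_cast
  rfl

/-- `t ↦ q^{-t}` is injective on the reals for `q ≥ 2`. [cite: Casselman1980, §3] -/
theorem qVar_ofReal_injective {q : ℕ} (hq : 2 ≤ q) : Function.Injective fun t : ℝ => qVar q (t : ℂ) := by
  intro t₁ t₂ h
  simp only [qVar_ofReal, Complex.ofReal_inj] at h
  have hq1 : (1 : ℝ) < q := by exact_mod_cast hq
  have hmono : StrictAnti fun t : ℝ => (q : ℝ) ^ (-t) := fun a b hab =>
    Real.rpow_lt_rpow_of_exponent_lt hq1 (neg_lt_neg hab)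
  exact hmono.injective h

/-- For `Q ≠ 0` the set of real `t` with `Q(q^{-t}) = 0` is finite (`q ≥ 2`). [cite: Casselman1980, §3] -/
theorem finite_setOf_eval_qVar_eq_zero {q : ℕ} (hq : 2 ≤ q) {Q : ℂ[X]} (hQ : Q ≠ 0) :
    {t : ℝ | Q.eval (qVar q (t : ℂ)) = 0}.Finite := by
  have h : {t : ℝ | Q.eval (qVar q (t : ℂ)) = 0} = (fun t : ℝ => qVar q (t : ℂ)) ⁻¹' {x | Q.IsRoot x} := rfl
  rw [h]
  exact (Polynomial.finite_setOf_isRoot hQ).preimage (qVar_ofReal_injective hq).injOn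

/-! ## §2 The predicates -/

/-- **`φ` is a rational function of `q^{-s}`**: `φ s = P(q^{-s}) / Q(q^{-s})` for some polynomials `P`, `Q ≠ 0`, at every `s` with
`Q(q^{-s}) ≠ 0` (no constraint at the finitely-many-mod-`2πi/log q` remaining points). [cite: KudlaSweet1997, §1] [cite: Casselman1980, §3] -/
def IsQRational (q : ℕ) (φ : ℂ → ℂ) : Prop :=
  ∃ P Q : ℂ[X], Q ≠ 0 ∧ ∀ s : ℂ, Q.eval (qVar q s) ≠ 0 → φ s = P.eval (qVar q s) / Q.eval (qVar q s)

/-- **`φ` is a rational function of `q^{-s}` regular at `s₀`**: as `IsQRational`, with a denominator not vanishing at `q^{-s₀}` — so the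
value `φ s₀` IS the value of the rational function. [cite: KudlaSweet1997, §1] [cite: Casselman1980, §3] -/
def IsQRationalRegularAt (q : ℕ) (s₀ : ℂ) (φ : ℂ → ℂ) : Prop :=
  ∃ P Q : ℂ[X], Q.eval (qVar q s₀) ≠ 0 ∧ ∀ s : ℂ, Q.eval (qVar q s) ≠ 0 → φ s = P.eval (qVar q s) / Q.eval (qVar q s)

variable {q : ℕ} {s₀ : ℂ} {φ ψ : ℂ → ℂ}

/-- regular at `s₀` ⟹ rational. [cite: KudlaSweet1997, §1] -/
theorem IsQRationalRegularAt.isQRational (h : IsQRationalRegularAt q s₀ φ) : IsQRational q φ := by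
  obtain ⟨P, Q, hQ, hφ⟩ := h
  exact ⟨P, Q, fun h0 => hQ (by rw [h0, eval_zero]), hφ⟩

/-- Changing `φ` at points where it is not constrained: if `ψ` agrees with `φ` wherever some admissible denominator of `φ` is non-zero…
in practice: `φ = ψ` everywhere transfers the predicate. [cite: KudlaSweet1997, §1] -/
theorem IsQRationalRegularAt.congr (h : IsQRationalRegularAt q s₀ φ) (hφψ : ∀ s, φ s = ψ s) : IsQRationalRegularAt q s₀ ψ := by
  obtain ⟨P, Q, hQ, hφ⟩ := h
  exact ⟨P, Q, hQ, fun s hs => (hφψ s) ▸ hφ s hs⟩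

/-- `IsQRational` is stable under everywhere-equality. [cite: KudlaSweet1997, §1] -/
theorem IsQRational.congr (h : IsQRational q φ) (hφψ : ∀ s, φ s = ψ s) : IsQRational q ψ := by
  obtain ⟨P, Q, hQ, hφ⟩ := h
  exact ⟨P, Q, hQ, fun s hs => (hφψ s) ▸ hφ s hs⟩

/-! ## §3 Closure properties (regular at `s₀`) -/

/-- a polynomial in `q^{-s}` is regular everywhere. [cite: Casselman1980, §3] -/
theorem isQRationalRegularAt_eval (q : ℕ) (s₀ : ℂ) (P : ℂ[X]) :
    IsQRationalRegularAt q s₀ fun s => P.eval (qVar q s) :=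
  ⟨P, 1, by simp, fun s _ => by simp⟩

/-- constants are regular everywhere. [cite: Casselman1980, §3] -/
theorem isQRationalRegularAt_const (q : ℕ) (s₀ : ℂ) (c : ℂ) : IsQRationalRegularAt q s₀ fun _ => c := by
  simpa using isQRationalRegularAt_eval q s₀ (C c)

/-- `q^{-ks} = (q^{-s})^k` is regular everywhere. [cite: Casselman1980, §3] -/
theorem isQRationalRegularAt_qVar_pow (q : ℕ) (s₀ : ℂ) (k : ℕ) : IsQRationalRegularAt q s₀ fun s => qVar q s ^ k := by
  simpa using isQRationalRegularAt_eval q s₀ (X ^ k)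

/-- sums of regular functions are regular. [cite: Casselman1980, §3] -/
theorem IsQRationalRegularAt.add (hφ : IsQRationalRegularAt q s₀ φ) (hψ : IsQRationalRegularAt q s₀ ψ) :
    IsQRationalRegularAt q s₀ fun s => φ s + ψ s := by
  obtain ⟨P₁, Q₁, hQ₁, h₁⟩ := hφ
  obtain ⟨P₂, Q₂, hQ₂, h₂⟩ := hψ
  refine ⟨P₁ * Q₂ + P₂ * Q₁, Q₁ * Q₂, by rw [eval_mul]; exact mul_ne_zero hQ₁ hQ₂, fun s hs => ?_⟩
  rw [eval_mul] at hs
  show φ s + ψ s = _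
  rw [h₁ s (left_ne_zero_of_mul hs), h₂ s (right_ne_zero_of_mul hs), eval_add, eval_mul, eval_mul, eval_mul,
    div_add_div _ _ (left_ne_zero_of_mul hs) (right_ne_zero_of_mul hs)]
  ring

/-- products of regular functions are regular. [cite: Casselman1980, §3] -/
theorem IsQRationalRegularAt.mul (hφ : IsQRationalRegularAt q s₀ φ) (hψ : IsQRationalRegularAt q s₀ ψ) :
    IsQRationalRegularAt q s₀ fun s => φ s * ψ s := by
  obtain ⟨P₁, Q₁, hQ₁, h₁⟩ := hφ
  obtain ⟨P₂, Q₂, hQ₂, h₂⟩ := hψ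
  refine ⟨P₁ * P₂, Q₁ * Q₂, by rw [eval_mul]; exact mul_ne_zero hQ₁ hQ₂, fun s hs => ?_⟩
  rw [eval_mul] at hs
  show φ s * ψ s = _
  rw [h₁ s (left_ne_zero_of_mul hs), h₂ s (right_ne_zero_of_mul hs), eval_mul, eval_mul,
    div_mul_div_comm]

/-- scalar multiples of regular functions are regular. [cite: Casselman1980, §3] -/
theorem IsQRationalRegularAt.const_mul (hφ : IsQRationalRegularAt q s₀ φ) (c : ℂ) :
    IsQRationalRegularAt q s₀ fun s => c * φ s :=
  (isQRationalRegularAt_const q s₀ c).mul hφ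

/-- negatives of regular functions are regular. [cite: Casselman1980, §3] -/
theorem IsQRationalRegularAt.neg (hφ : IsQRationalRegularAt q s₀ φ) : IsQRationalRegularAt q s₀ fun s => -φ s := by
  simpa using hφ.const_mul (-1)

/-- differences of regular functions are regular. [cite: Casselman1980, §3] -/
theorem IsQRationalRegularAt.sub (hφ : IsQRationalRegularAt q s₀ φ) (hψ : IsQRationalRegularAt q s₀ ψ) :
    IsQRationalRegularAt q s₀ fun s => φ s - ψ s := by
  simpa [sub_eq_add_neg] using hφ.add hψ.neg

/-- finite sums of regular functions are regular. [cite: Casselman1980, §3] -/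
theorem IsQRationalRegularAt.sum {ι : Type*} (S : Finset ι) {Φ : ι → ℂ → ℂ}
    (h : ∀ i ∈ S, IsQRationalRegularAt q s₀ (Φ i)) : IsQRationalRegularAt q s₀ fun s => ∑ i ∈ S, Φ i s := by
  classical
  induction S using Finset.induction_on with
  | empty => simpa using isQRationalRegularAt_const q s₀ 0
  | insert a S ha ih =>
    simpa [Finset.sum_insert ha] using
      (h a (Finset.mem_insert_self a S)).add (ih fun i hi => h i (Finset.mem_insert_of_mem hi))

/-- finite products of regular functions are regular. [cite: Casselman1980, §3] -/
theorem IsQRationalRegularAt.prod {ι : Type*} (S : Finset ι) {Φ : ι → ℂ → ℂ}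
    (h : ∀ i ∈ S, IsQRationalRegularAt q s₀ (Φ i)) : IsQRationalRegularAt q s₀ fun s => ∏ i ∈ S, Φ i s := by
  classical
  induction S using Finset.induction_on with
  | empty => simpa using isQRationalRegularAt_const q s₀ 1
  | insert a S ha ih =>
    simpa [Finset.prod_insert ha] using
      (h a (Finset.mem_insert_self a S)).mul (ih fun i hi => h i (Finset.mem_insert_of_mem hi))

/-- The value at `s₀` of a regular function is the value of (any of) its rational expressions. [cite: KudlaSweet1997, §1] -/
theorem IsQRationalRegularAt.exists_eval_eq (hφ : IsQRationalRegularAt q s₀ φ) :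
    ∃ P Q : ℂ[X], Q.eval (qVar q s₀) ≠ 0 ∧ φ s₀ = P.eval (qVar q s₀) / Q.eval (qVar q s₀) ∧
      ∀ s : ℂ, Q.eval (qVar q s) ≠ 0 → φ s = P.eval (qVar q s) / Q.eval (qVar q s) := by
  obtain ⟨P, Q, hQ, h⟩ := hφ
  exact ⟨P, Q, hQ, h s₀ hQ, h⟩

/-- inverses of regular functions not vanishing at `s₀` are regular at `s₀`. [cite: Casselman1980, §3] -/
theorem IsQRationalRegularAt.inv (hφ : IsQRationalRegularAt q s₀ φ) (h0 : φ s₀ ≠ 0) :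
    IsQRationalRegularAt q s₀ fun s => (φ s)⁻¹ := by
  obtain ⟨P, Q, hQ, h⟩ := hφ
  have hP : P.eval (qVar q s₀) ≠ 0 := by
    intro hP
    exact h0 (by rw [h s₀ hQ, hP, zero_div])
  refine ⟨Q * Q, P * Q, by rw [eval_mul]; exact mul_ne_zero hP hQ, fun s hs => ?_⟩
  rw [eval_mul] at hs
  show (φ s)⁻¹ = _
  rw [h s (right_ne_zero_of_mul hs), eval_mul, eval_mul, inv_div,
    mul_div_mul_right _ _ (right_ne_zero_of_mul hs)]

/-- quotients of regular functions with denominator non-vanishing at `s₀` are regular at `s₀`. [cite: Casselman1980, §3] -/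
theorem IsQRationalRegularAt.div (hφ : IsQRationalRegularAt q s₀ φ) (hψ : IsQRationalRegularAt q s₀ ψ) (h0 : ψ s₀ ≠ 0) :
    IsQRationalRegularAt q s₀ fun s => φ s / ψ s := by
  simpa [div_eq_mul_inv] using hφ.mul (hψ.inv h0)

/-! ## §4 Closure properties (rational) -/

/-- a polynomial in `q^{-s}` is rational. [cite: Casselman1980, §3] -/
theorem isQRational_eval (q : ℕ) (P : ℂ[X]) : IsQRational q fun s => P.eval (qVar q s) :=
  (isQRationalRegularAt_eval q 0 P).isQRational

/-- constants are rational. [cite: Casselman1980, §3] -/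
theorem isQRational_const (q : ℕ) (c : ℂ) : IsQRational q fun _ => c :=
  (isQRationalRegularAt_const q 0 c).isQRational

/-- sums of rational functions are rational. [cite: Casselman1980, §3] -/
theorem IsQRational.add (hφ : IsQRational q φ) (hψ : IsQRational q ψ) : IsQRational q fun s => φ s + ψ s := by
  obtain ⟨P₁, Q₁, hQ₁, h₁⟩ := hφ
  obtain ⟨P₂, Q₂, hQ₂, h₂⟩ := hψ
  refine ⟨P₁ * Q₂ + P₂ * Q₁, Q₁ * Q₂, mul_ne_zero hQ₁ hQ₂, fun s hs => ?_⟩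
  rw [eval_mul] at hs
  show φ s + ψ s = _
  rw [h₁ s (left_ne_zero_of_mul hs), h₂ s (right_ne_zero_of_mul hs), eval_add, eval_mul, eval_mul, eval_mul,
    div_add_div _ _ (left_ne_zero_of_mul hs) (right_ne_zero_of_mul hs)]
  ring

/-- products of rational functions are rational. [cite: Casselman1980, §3] -/
theorem IsQRational.mul (hφ : IsQRational q φ) (hψ : IsQRational q ψ) : IsQRational q fun s => φ s * ψ s := by
  obtain ⟨P₁, Q₁, hQ₁, h₁⟩ := hφ
  obtain ⟨P₂, Q₂, hQ₂, h₂⟩ := hψ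
  refine ⟨P₁ * P₂, Q₁ * Q₂, mul_ne_zero hQ₁ hQ₂, fun s hs => ?_⟩
  rw [eval_mul] at hs
  show φ s * ψ s = _
  rw [h₁ s (left_ne_zero_of_mul hs), h₂ s (right_ne_zero_of_mul hs), eval_mul, eval_mul, div_mul_div_comm]

/-- scalar multiples of rational functions are rational. [cite: Casselman1980, §3] -/
theorem IsQRational.const_mul (hφ : IsQRational q φ) (c : ℂ) : IsQRational q fun s => c * φ s :=
  (isQRational_const q c).mul hφ

/-- finite sums of rational functions are rational. [cite: Casselman1980, §3] -/
theorem IsQRational.sum {ι : Type*} (S : Finset ι) {Φ : ι → ℂ → ℂ} (h : ∀ i ∈ S, IsQRational q (Φ i)) :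
    IsQRational q fun s => ∑ i ∈ S, Φ i s := by
  classical
  induction S using Finset.induction_on with
  | empty => simpa using isQRational_const q 0
  | insert a S ha ih =>
    simpa [Finset.sum_insert ha] using
      (h a (Finset.mem_insert_self a S)).add (ih fun i hi => h i (Finset.mem_insert_of_mem hi))

/-- finite products of rational functions are rational. [cite: Casselman1980, §3] -/
theorem IsQRational.prod {ι : Type*} (S : Finset ι) {Φ : ι → ℂ → ℂ} (h : ∀ i ∈ S, IsQRational q (Φ i)) :
    IsQRational q fun s => ∏ i ∈ S, Φ i s := by
  classical
  induction S using Finset.induction_on with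
  | empty => simpa using isQRational_const q 1
  | insert a S ha ih =>
    simpa [Finset.prod_insert ha] using
      (h a (Finset.mem_insert_self a S)).mul (ih fun i hi => h i (Finset.mem_insert_of_mem hi))

/-! ## §5 The identity principle: the value at `s₀` is determined by the values on a right half-plane -/

/-- For `q ≥ 2`, real `t > a` avoiding the zeros of `Q₁(q^{-t})`, `Q₂(q^{-t})` (`Q₁, Q₂ ≠ 0`) form an infinite set. [cite: Casselman1980, §3] -/
theorem infinite_setOf_real_good (hq : 2 ≤ q) (a : ℝ) {Q₁ Q₂ : ℂ[X]} (hQ₁ : Q₁ ≠ 0) (hQ₂ : Q₂ ≠ 0) :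
    {t : ℝ | a < t ∧ Q₁.eval (qVar q (t : ℂ)) ≠ 0 ∧ Q₂.eval (qVar q (t : ℂ)) ≠ 0}.Infinite := by
  have h : {t : ℝ | a < t ∧ Q₁.eval (qVar q (t : ℂ)) ≠ 0 ∧ Q₂.eval (qVar q (t : ℂ)) ≠ 0} =
      Set.Ioi a \ ({t : ℝ | Q₁.eval (qVar q (t : ℂ)) = 0} ∪ {t : ℝ | Q₂.eval (qVar q (t : ℂ)) = 0}) := by
    ext t
    simp only [Set.mem_setOf_eq, Set.mem_sdiff, Set.mem_Ioi, Set.mem_union, not_or]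
  rw [h]
  exact (Set.Ioi_infinite a).sdiff
    ((finite_setOf_eval_qVar_eq_zero hq hQ₁).union (finite_setOf_eval_qVar_eq_zero hq hQ₂))

/-- **Identity principle.** Two functions rational in `q^{-s}` (`q ≥ 2`) and regular at `s₀` which agree on a right half-plane
`a < re s` agree at `s₀`: the difference of cross-products `P₁Q₂ − P₂Q₁` has infinitely many roots `q^{-t}`, `t > a` real, hence
vanishes, and both denominators are non-zero at `q^{-s₀}`.  This is what makes «the value at `½` of the rational continuation»
well defined for consumers of (A4′). [cite: KudlaSweet1997, §1] [cite: Casselman1980, §3] -/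
theorem IsQRationalRegularAt.eq_of_eqOn_halfPlane (hq : 2 ≤ q) (hφ : IsQRationalRegularAt q s₀ φ)
    (hψ : IsQRationalRegularAt q s₀ ψ) (a : ℝ) (h : ∀ s : ℂ, a < s.re → φ s = ψ s) : φ s₀ = ψ s₀ := by
  obtain ⟨P₁, Q₁, hQ₁, h₁⟩ := hφ
  obtain ⟨P₂, Q₂, hQ₂, h₂⟩ := hψ
  have hQ₁0 : Q₁ ≠ 0 := fun h0 => hQ₁ (by rw [h0, eval_zero])
  have hQ₂0 : Q₂ ≠ 0 := fun h0 => hQ₂ (by rw [h0, eval_zero])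
  -- the cross difference vanishes at every good real point
  have hD : P₁ * Q₂ - P₂ * Q₁ = 0 := by
    apply Polynomial.eq_zero_of_infinite_isRoot
    refine ((infinite_setOf_real_good hq a hQ₁0 hQ₂0).image (qVar_ofReal_injective hq).injOn).mono ?_
    rintro x ⟨t, ⟨hta, ht₁, ht₂⟩, rfl⟩
    have hts : a < (t : ℂ).re := by simpa using hta
    have e := h (t : ℂ) hts
    rw [h₁ _ ht₁, h₂ _ ht₂, div_eq_div_iff ht₁ ht₂] at e
    simp only [Set.mem_setOf_eq, IsRoot.def, eval_sub, eval_mul, e, sub_self]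
  have e0 : P₁.eval (qVar q s₀) * Q₂.eval (qVar q s₀) = P₂.eval (qVar q s₀) * Q₁.eval (qVar q s₀) := by
    have := congrArg (fun R : ℂ[X] => R.eval (qVar q s₀)) hD
    simpa [eval_sub, eval_mul, sub_eq_zero] using this
  rw [h₁ s₀ hQ₁, h₂ s₀ hQ₂, div_eq_div_iff hQ₁ hQ₂]
  exact e0

end Summit.HodgeConjecture.HodgeConjecture.Cruxes.HLiu418.K2LiuQRationalDefs

end
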